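import Summits.NavierStokesRegularity.FluidComputer.PlaneVorticityFluxLaw
import HarnessLib

/-!
# Plane flux law for the normal vorticity, II (no symmetry) — the `d/dt` form along a classical
# Navier–Stokes / Euler flow, the NO-CROSSING reduction, and the sign form

HONEST FRAMING (cell `ns-blowup`, lane W, seat `ns-blowup-wind` g5; human ruling D-0035). WHAT
THIS IS NOT: not a statement about Navier–Stokes blow-up in either direction and not about any
particular flow. It is the genuine `d/dt` form of the general plane flux law of the companion
`PlaneVorticityFluxLaw.lean` (`setIntegral_plane_vorticity_eq`, stated there for `∫_R ∂ₜωᵢ`):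
the derivative is taken OUTSIDE the integral by differentiation under the integral sign within a
compact convex time set (the tree's `hasDerivWithinAt_integral_of_dominated_convex`; domination
from joint continuity of `∂ₜω` on `S × P([a,b])`), exactly as `SymmetryPlaneFluxRate.lean` (g4)
does on a mirror plane — here for ANY classical flow and ANY fixed affine plane rectangle.

* `hasDerivWithinAt_setIntegral_curl_plane` — for `IsClassicalNSSolutionOn S ν f u p` on `ℝ³`
  (any real `ν`, Euler included; any force) on a COMPACT CONVEX time set `S` of unique
  differentiability with `S ⊆ closure (interior S)` (a slab; maximal solutions are restricted to
  sub-slabs first), the normal-vorticity content `s ↦ ∫_R (curl u(s))ᵢ` of a fixed rectangle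
  `R = P([a,b])`, `P (s,t) = x₀ + s e_{i+1} + t e_{i+2}`, has within `S` at every `t ∈ S` the
  derivative `ν ∫_R ∑ⱼ∂ⱼ∂ⱼωᵢ − ∮_{∂R} (ωᵢ u_∥ − uᵢ ω_∥)·n_out + ∫_R (curl f)ᵢ` (two rim channels:
  in-plane advection of `ωᵢ`; normal-velocity transport of rim-threading `ω_∥`).
* `hasDerivWithinAt_setIntegral_curl_plane_of_noCrossing` — **NO-CROSSING reduction**: if at time
  `t` the normal velocity vanishes on the rim `∂R` (no material crossing of the plane along the
  rim), the second channel is absent and the derivative is the mirror-plane expression of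
  `SymmetryPlaneFluxRate.hasDerivWithinAt_setIntegral_curl_mirrorPlane` — WITHOUT any symmetry.
  This is the kinematic content of the lane's CROSSING COUNT instrument (RESULT P-WIND-3, a MODEL
  memo; nothing here depends on it): where no material point crosses the plane at the rim of the
  fixed region, normal flux can enter it inviscidly only by in-plane advection across the rim.
* `rim_advection_nonneg_of_outflow` + `deriv_le_of_noCrossing_outflow` — **sign form**: if moreover
  `ωᵢ ≥ 0` on the rim and the in-plane velocity points outward there, the inviscid unforced part
  of the derivative is `≤ 0`: the rate is at most `ν ∫_R ∑ⱼ∂ⱼ∂ⱼωᵢ + ∫_R (curl f)ᵢ` — any gain of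
  co-signed normal flux through the fixed region is then viscous (or forced).

All proved; 0 `sorry`; no definitions, no named facts. References: Majda–Bertozzi 2002 §1.4
(1.33), §1.6; folklore (differentiation under the integral sign).
-/

noncomputable section

open MeasureTheory Set Function Filter Topology
open scoped BigOperators

namespace Summit.NavierStokesRegularity.FluidComputer.PlaneVorticityFluxLaw

open Literature.Analysis.FluidPDE Summit.NavierStokesRegularity.FluidComputer.SymmetryPlaneFluxLaw

section Rate

open scoped ContDiff

variable {S : Set ℝ} {ν : ℝ} {f u : ℝ → EuclideanSpace ℝ (Fin 3) → EuclideanSpace ℝ (Fin 3)}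
  {p : ℝ → EuclideanSpace ℝ (Fin 3) → ℝ}

/-- The affine chart `(s, t) ↦ x₀ + s e_{i+1} + t e_{i+2}` parametrises the plane
`{xᵢ = (x₀)ᵢ}` through `x₀` normal to `eᵢ`: its `i`-th coordinate is constant (so `P([a,b])` is
a rectangle of that FIXED plane). -/
theorem planeChartAt_apply_same (i : Fin 3) {x₀ : EuclideanSpace ℝ (Fin 3)}
    {P : ℝ × ℝ → EuclideanSpace ℝ (Fin 3)}
    (hP : ∀ q, P q = x₀ + (q.1 • (stdVec (i + 1) : EuclideanSpace ℝ (Fin 3)) + q.2 • stdVec (i + 2)))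
    (q : ℝ × ℝ) : P q i = x₀ i := by
  rw [hP]
  have h1 : (i : Fin 3) ≠ i + 1 := by fin_cases i <;> decide
  have h2 : (i : Fin 3) ≠ i + 2 := by fin_cases i <;> decide
  simp [h1, h2]

/-- **The general plane flux law, `d/dt` form.** Along a classical Navier–Stokes / Euler solution
on a compact convex time set, the normal-vorticity content `s ↦ ∫_R (curl u(s))ᵢ` of a fixed
rectangle `R = P([a,b])` of the affine plane through `x₀` normal to `eᵢ` has, within `S` at every
`t ∈ S`, the derivative
`ν ∫_R ∑ⱼ∂ⱼ∂ⱼωᵢ − ([∫ (u_{i+2}ωᵢ − uᵢω_{i+2}) ds]_{t=a₂}^{t=b₂} + [∫ (u_{i+1}ωᵢ − uᵢω_{i+1}) dt]_{s=a₁}^{s=b₁}) + ∫_R (curl f)ᵢ`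
— viscous diffusion, minus the outward rim flux `(ωᵢ u_∥ − uᵢ ω_∥) · n_out`, plus the curl of
the force. No symmetry hypothesis. -/
theorem hasDerivWithinAt_setIntegral_curl_plane
    (h : IsClassicalNSSolutionOn S ν f u p) (hSc : IsCompact S) (hconv : Convex ℝ S)
    (hS : UniqueDiffOn ℝ S) (hcl : S ⊆ closure (interior S)) {t : ℝ} (ht : t ∈ S) (i : Fin 3)
    {x₀ : EuclideanSpace ℝ (Fin 3)} {P : ℝ × ℝ → EuclideanSpace ℝ (Fin 3)}
    (hP : ∀ q, P q = x₀ + (q.1 • (stdVec (i + 1) : EuclideanSpace ℝ (Fin 3)) + q.2 • stdVec (i + 2)))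
    {a b : ℝ × ℝ} (hab : a ≤ b) :
    HasDerivWithinAt (fun s => ∫ q in Icc a b, curl (u s) (P q) i)
      (ν * (∫ q in Icc a b, ∑ j, pderiv j (pderiv j fun y => curl (u t) y i) (P q)) -
        ((((∫ s in a.1..b.1, (u t (P (s, b.2)) (i + 2) * curl (u t) (P (s, b.2)) i -
              u t (P (s, b.2)) i * curl (u t) (P (s, b.2)) (i + 2))) -
            ∫ s in a.1..b.1, (u t (P (s, a.2)) (i + 2) * curl (u t) (P (s, a.2)) i -
              u t (P (s, a.2)) i * curl (u t) (P (s, a.2)) (i + 2))) +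
          ∫ r in a.2..b.2, (u t (P (b.1, r)) (i + 1) * curl (u t) (P (b.1, r)) i -
            u t (P (b.1, r)) i * curl (u t) (P (b.1, r)) (i + 1))) -
        ∫ r in a.2..b.2, (u t (P (a.1, r)) (i + 1) * curl (u t) (P (a.1, r)) i -
          u t (P (a.1, r)) i * curl (u t) (P (a.1, r)) (i + 1))) +
      ∫ q in Icc a b, curl (f t) (P q) i) S t := by
  -- the field, its time derivative, and their regularity (opaque names with defining equations)
  obtain ⟨W, hWdef⟩ : ∃ W : ℝ → EuclideanSpace ℝ (Fin 3) → ℝ, W = fun s y => curl (u s) y i :=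
    ⟨_, rfl⟩
  have hW : IsSmoothSpaceTimeOn S W := hWdef ▸ isSmoothSpaceTimeOn_curl_apply h hS i
  obtain ⟨G, hGdef⟩ : ∃ G : ℝ → EuclideanSpace ℝ (Fin 3) → ℝ,
      G = Literature.Analysis.FluidPDE.timeDerivWithin S W := ⟨_, rfl⟩
  have hG : IsSmoothSpaceTimeOn S G := hGdef ▸ hW.timeDerivWithin hS
  have hPc : Continuous P := continuous_planeChartAt i hP
  -- the clamp onto the rectangle (to state a global domination)
  obtain ⟨ρ, hρdef⟩ : ∃ ρ : ℝ × ℝ → ℝ × ℝ,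
      ρ = fun q => (max a.1 (min b.1 q.1), max a.2 (min b.2 q.2)) := ⟨_, rfl⟩
  have hρc : Continuous ρ := by
    rw [hρdef]
    refine Continuous.prodMk ?_ ?_
    · exact continuous_const.max (continuous_const.min continuous_fst)
    · exact continuous_const.max (continuous_const.min continuous_snd)
  have hρmem : ∀ q, ρ q ∈ Icc a b := fun q => by
    rw [hρdef]
    exact ⟨⟨le_max_left _ _, le_max_left _ _⟩,
      ⟨max_le hab.1 (min_le_left _ _), max_le hab.2 (min_le_left _ _)⟩⟩
  have hρid : ∀ q ∈ Icc a b, ρ q = q := by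
    rintro ⟨q₁, q₂⟩ ⟨⟨h1, h2⟩, ⟨h3, h4⟩⟩
    rw [hρdef]
    simp only [Prod.mk.injEq]
    exact ⟨by rw [min_eq_right h3, max_eq_right h1], by rw [min_eq_right h4, max_eq_right h2]⟩
  -- a uniform bound for the time derivative on the compact `S × [a, b]`
  have hGc : ContinuousOn (fun z : ℝ × (ℝ × ℝ) => G z.1 (P z.2)) (S ×ˢ univ) := by
    have h1 : ContinuousOn (uncurry G) (S ×ˢ univ) := hG.continuousOn
    have h2 : Continuous fun z : ℝ × (ℝ × ℝ) => ((z.1, P z.2) : ℝ × EuclideanSpace ℝ (Fin 3)) :=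
      continuous_fst.prodMk (hPc.comp continuous_snd)
    exact h1.comp h2.continuousOn fun z hz => ⟨hz.1, mem_univ _⟩
  obtain ⟨M, hM⟩ : ∃ M, ∀ z ∈ S ×ˢ Icc a b, ‖G z.1 (P z.2)‖ ≤ M :=
    (hSc.prod isCompact_Icc).exists_bound_of_continuousOn
      (hGc.mono (prod_mono Subset.rfl (subset_univ _)))
  -- differentiation under the integral sign within the convex time set
  obtain ⟨F, hFdef⟩ : ∃ F : ℝ → ℝ × ℝ → ℝ, F = fun s q => W s (P (ρ q)) := ⟨_, rfl⟩
  obtain ⟨F', hF'def⟩ : ∃ F' : ℝ → ℝ × ℝ → ℝ, F' = fun s q => G s (P (ρ q)) := ⟨_, rfl⟩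
  have hFc : ∀ s ∈ S, Continuous (F s) := fun s hs => by
    rw [hFdef]
    exact ((hW.contDiff_slice hs).continuous.comp hPc).comp hρc
  have h1 : ∀ s ∈ S, AEStronglyMeasurable (F s) (volume.restrict (Icc a b)) :=
    fun s hs => (hFc s hs).aestronglyMeasurable
  have h2 : Integrable (F t) (volume.restrict (Icc a b)) :=
    (hFc t ht).continuousOn.integrableOn_compact isCompact_Icc
  have h3 : ∀ s ∈ S, ∀ q, ‖F' s q‖ ≤ (fun _ : ℝ × ℝ => M) q := fun s hs q => by
    rw [hF'def]
    exact hM (s, ρ q) ⟨hs, hρmem q⟩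
  have h4 : Integrable (fun _ : ℝ × ℝ => M) (volume.restrict (Icc a b)) :=
    continuous_const.continuousOn.integrableOn_compact isCompact_Icc
  have h5 : ∀ s ∈ S, ∀ q, HasDerivWithinAt (fun s' => F s' q) (F' s q) S s := fun s hs q => by
    rw [hFdef, hF'def, hGdef]
    exact hW.hasDerivWithinAt_timeDerivWithin hS hs (P (ρ q))
  have hkey : HasDerivWithinAt (fun s => ∫ q in Icc a b, F s q) (∫ q in Icc a b, F' t q) S t :=
    hasDerivWithinAt_integral_of_dominated_convex hconv ht h1 h2 h3 h4 h5
  -- undo the clamp inside the rectangle and insert the integrated law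
  have hFeq : (fun s => ∫ q in Icc a b, F s q) = fun s => ∫ q in Icc a b, curl (u s) (P q) i := by
    funext s
    exact setIntegral_congr_fun measurableSet_Icc fun q hq => by
      simp only [hFdef, hWdef, hρid q hq]
  have hF'eq : ∫ q in Icc a b, F' t q =
      ∫ q in Icc a b, Literature.Analysis.FluidPDE.timeDerivWithin S
        (fun s y => curl (u s) y i) t (P q) :=
    setIntegral_congr_fun measurableSet_Icc fun q hq => by
      simp only [hF'def, hGdef, hWdef, hρid q hq]
  rw [hFeq, hF'eq, setIntegral_plane_vorticity_eq h hS hcl ht i hP hab] at hkey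
  exact hkey

/-- **NO-CROSSING reduction (the mirror-plane budget without any symmetry).** In the setting of
`hasDerivWithinAt_setIntegral_curl_plane`, suppose that at time `t` the NORMAL velocity vanishes
on the rim of the fixed plane rectangle, `uᵢ = 0` on `∂R` (no material point crosses the plane
along the rim). Then the second rim channel is absent and
`d/dt ∫_R ωᵢ = ν ∫_R ∑ⱼ∂ⱼ∂ⱼωᵢ − ∮_{∂R} ωᵢ (u_∥ · n_out) + ∫_R (curl f)ᵢ` — literally the
mirror-plane expression of `SymmetryPlaneFluxRate.hasDerivWithinAt_setIntegral_curl_mirrorPlane`,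
now for an arbitrary classical flow and an arbitrary affine plane: normal flux enters a fixed plane
region inviscidly only by in-plane advection across its rim. -/
theorem hasDerivWithinAt_setIntegral_curl_plane_of_noCrossing
    (h : IsClassicalNSSolutionOn S ν f u p) (hSc : IsCompact S) (hconv : Convex ℝ S)
    (hS : UniqueDiffOn ℝ S) (hcl : S ⊆ closure (interior S)) {t : ℝ} (ht : t ∈ S) (i : Fin 3)
    {x₀ : EuclideanSpace ℝ (Fin 3)} {P : ℝ × ℝ → EuclideanSpace ℝ (Fin 3)}
    (hP : ∀ q, P q = x₀ + (q.1 • (stdVec (i + 1) : EuclideanSpace ℝ (Fin 3)) + q.2 • stdVec (i + 2)))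
    {a b : ℝ × ℝ} (hab : a ≤ b)
    (hua1 : ∀ r ∈ Icc a.2 b.2, u t (P (a.1, r)) i = 0) (hub1 : ∀ r ∈ Icc a.2 b.2, u t (P (b.1, r)) i = 0)
    (hua2 : ∀ s ∈ Icc a.1 b.1, u t (P (s, a.2)) i = 0) (hub2 : ∀ s ∈ Icc a.1 b.1, u t (P (s, b.2)) i = 0) :
    HasDerivWithinAt (fun s => ∫ q in Icc a b, curl (u s) (P q) i)
      (ν * (∫ q in Icc a b, ∑ j, pderiv j (pderiv j fun y => curl (u t) y i) (P q)) -
        ((((∫ s in a.1..b.1, u t (P (s, b.2)) (i + 2) * curl (u t) (P (s, b.2)) i) -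
            ∫ s in a.1..b.1, u t (P (s, a.2)) (i + 2) * curl (u t) (P (s, a.2)) i) +
          ∫ r in a.2..b.2, u t (P (b.1, r)) (i + 1) * curl (u t) (P (b.1, r)) i) -
        ∫ r in a.2..b.2, u t (P (a.1, r)) (i + 1) * curl (u t) (P (a.1, r)) i) +
      ∫ q in Icc a b, curl (f t) (P q) i) S t := by
  have key := hasDerivWithinAt_setIntegral_curl_plane h hSc hconv hS hcl ht i hP hab
  have e1 : ∫ s in a.1..b.1, (u t (P (s, b.2)) (i + 2) * curl (u t) (P (s, b.2)) i -
      u t (P (s, b.2)) i * curl (u t) (P (s, b.2)) (i + 2)) =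
      ∫ s in a.1..b.1, u t (P (s, b.2)) (i + 2) * curl (u t) (P (s, b.2)) i :=
    intervalIntegral.integral_congr fun s hs => by
      have hs' : s ∈ Icc a.1 b.1 := by rwa [uIcc_of_le hab.1] at hs
      simp only [hub2 s hs', zero_mul, sub_zero]
  have e2 : ∫ s in a.1..b.1, (u t (P (s, a.2)) (i + 2) * curl (u t) (P (s, a.2)) i -
      u t (P (s, a.2)) i * curl (u t) (P (s, a.2)) (i + 2)) =
      ∫ s in a.1..b.1, u t (P (s, a.2)) (i + 2) * curl (u t) (P (s, a.2)) i :=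
    intervalIntegral.integral_congr fun s hs => by
      have hs' : s ∈ Icc a.1 b.1 := by rwa [uIcc_of_le hab.1] at hs
      simp only [hua2 s hs', zero_mul, sub_zero]
  have e3 : ∫ r in a.2..b.2, (u t (P (b.1, r)) (i + 1) * curl (u t) (P (b.1, r)) i -
      u t (P (b.1, r)) i * curl (u t) (P (b.1, r)) (i + 1)) =
      ∫ r in a.2..b.2, u t (P (b.1, r)) (i + 1) * curl (u t) (P (b.1, r)) i :=
    intervalIntegral.integral_congr fun r hr => by
      have hr' : r ∈ Icc a.2 b.2 := by rwa [uIcc_of_le hab.2] at hr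
      simp only [hub1 r hr', zero_mul, sub_zero]
  have e4 : ∫ r in a.2..b.2, (u t (P (a.1, r)) (i + 1) * curl (u t) (P (a.1, r)) i -
      u t (P (a.1, r)) i * curl (u t) (P (a.1, r)) (i + 1)) =
      ∫ r in a.2..b.2, u t (P (a.1, r)) (i + 1) * curl (u t) (P (a.1, r)) i :=
    intervalIntegral.integral_congr fun r hr => by
      have hr' : r ∈ Icc a.2 b.2 := by rwa [uIcc_of_le hab.2] at hr
      simp only [hua1 r hr', zero_mul, sub_zero]
  rw [e1, e2, e3, e4] at key
  exact key

/-- **Sign of the in-plane rim advection under outflow.** If on the rim of the plane rectangle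
the normal vorticity is co-signed, `ωᵢ ≥ 0`, and the in-plane velocity points OUTWARD
(`u_{i+1} ≤ 0` on `s = a₁`, `≥ 0` on `s = b₁`; `u_{i+2} ≤ 0` on `t = a₂`, `≥ 0` on `t = b₂`), then
the outward advective rim flux `∮_{∂R} ωᵢ (u_∥ · n_out)` is `≥ 0` (stated for arbitrary fields
`v, w` at the rim points of the chart). -/
theorem rim_advection_nonneg_of_outflow (i : Fin 3)
    {v w : EuclideanSpace ℝ (Fin 3) → EuclideanSpace ℝ (Fin 3)} {P : ℝ × ℝ → EuclideanSpace ℝ (Fin 3)}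
    {a b : ℝ × ℝ} (hab : a ≤ b)
    (hwa1 : ∀ r ∈ Icc a.2 b.2, 0 ≤ w (P (a.1, r)) i) (hwb1 : ∀ r ∈ Icc a.2 b.2, 0 ≤ w (P (b.1, r)) i)
    (hwa2 : ∀ s ∈ Icc a.1 b.1, 0 ≤ w (P (s, a.2)) i) (hwb2 : ∀ s ∈ Icc a.1 b.1, 0 ≤ w (P (s, b.2)) i)
    (hva1 : ∀ r ∈ Icc a.2 b.2, v (P (a.1, r)) (i + 1) ≤ 0)
    (hvb1 : ∀ r ∈ Icc a.2 b.2, 0 ≤ v (P (b.1, r)) (i + 1))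
    (hva2 : ∀ s ∈ Icc a.1 b.1, v (P (s, a.2)) (i + 2) ≤ 0)
    (hvb2 : ∀ s ∈ Icc a.1 b.1, 0 ≤ v (P (s, b.2)) (i + 2)) :
    0 ≤ (((∫ s in a.1..b.1, v (P (s, b.2)) (i + 2) * w (P (s, b.2)) i) -
          ∫ s in a.1..b.1, v (P (s, a.2)) (i + 2) * w (P (s, a.2)) i) +
        ∫ r in a.2..b.2, v (P (b.1, r)) (i + 1) * w (P (b.1, r)) i) -
      ∫ r in a.2..b.2, v (P (a.1, r)) (i + 1) * w (P (a.1, r)) i := by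
  have h1 : 0 ≤ ∫ s in a.1..b.1, v (P (s, b.2)) (i + 2) * w (P (s, b.2)) i :=
    intervalIntegral.integral_nonneg hab.1 fun s hs => mul_nonneg (hvb2 s hs) (hwb2 s hs)
  have h2 : ∫ s in a.1..b.1, v (P (s, a.2)) (i + 2) * w (P (s, a.2)) i ≤ 0 := by
    have h := intervalIntegral.integral_nonneg (μ := volume) hab.1
      (f := fun s => -(v (P (s, a.2)) (i + 2) * w (P (s, a.2)) i))
      fun s hs => by nlinarith [hva2 s hs, hwa2 s hs]
    rw [intervalIntegral.integral_neg] at h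
    linarith
  have h3 : 0 ≤ ∫ r in a.2..b.2, v (P (b.1, r)) (i + 1) * w (P (b.1, r)) i :=
    intervalIntegral.integral_nonneg hab.2 fun r hr => mul_nonneg (hvb1 r hr) (hwb1 r hr)
  have h4 : ∫ r in a.2..b.2, v (P (a.1, r)) (i + 1) * w (P (a.1, r)) i ≤ 0 := by
    have h := intervalIntegral.integral_nonneg (μ := volume) hab.2
      (f := fun r => -(v (P (a.1, r)) (i + 1) * w (P (a.1, r)) i))
      fun r hr => by nlinarith [hva1 r hr, hwa1 r hr]
    rw [intervalIntegral.integral_neg] at h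
    linarith
  linarith

/-- **Sign form of the general law (no crossing, outflow, co-signed rim ⇒ inviscid budget ≤ 0).**
In the setting of `hasDerivWithinAt_setIntegral_curl_plane_of_noCrossing`, if moreover `ωᵢ ≥ 0`
on the rim and the in-plane velocity points outward there, the normal-vorticity content of the
fixed plane rectangle has within `S` at `t` a derivative `D` with
`D ≤ ν ∫_R ∑ⱼ∂ⱼ∂ⱼωᵢ + ∫_R (curl f)ᵢ`: with no material crossing at the rim and the region's rim
points leaving, co-signed normal flux can only be carried OUT inviscidly — any gain through the
fixed region is viscous or forced. No symmetry hypothesis anywhere. -/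
theorem deriv_le_of_noCrossing_outflow
    (h : IsClassicalNSSolutionOn S ν f u p) (hSc : IsCompact S) (hconv : Convex ℝ S)
    (hS : UniqueDiffOn ℝ S) (hcl : S ⊆ closure (interior S)) {t : ℝ} (ht : t ∈ S) (i : Fin 3)
    {x₀ : EuclideanSpace ℝ (Fin 3)} {P : ℝ × ℝ → EuclideanSpace ℝ (Fin 3)}
    (hP : ∀ q, P q = x₀ + (q.1 • (stdVec (i + 1) : EuclideanSpace ℝ (Fin 3)) + q.2 • stdVec (i + 2)))
    {a b : ℝ × ℝ} (hab : a ≤ b)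
    (hua1 : ∀ r ∈ Icc a.2 b.2, u t (P (a.1, r)) i = 0) (hub1 : ∀ r ∈ Icc a.2 b.2, u t (P (b.1, r)) i = 0)
    (hua2 : ∀ s ∈ Icc a.1 b.1, u t (P (s, a.2)) i = 0) (hub2 : ∀ s ∈ Icc a.1 b.1, u t (P (s, b.2)) i = 0)
    (hwa1 : ∀ r ∈ Icc a.2 b.2, 0 ≤ curl (u t) (P (a.1, r)) i)
    (hwb1 : ∀ r ∈ Icc a.2 b.2, 0 ≤ curl (u t) (P (b.1, r)) i)
    (hwa2 : ∀ s ∈ Icc a.1 b.1, 0 ≤ curl (u t) (P (s, a.2)) i)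
    (hwb2 : ∀ s ∈ Icc a.1 b.1, 0 ≤ curl (u t) (P (s, b.2)) i)
    (hva1 : ∀ r ∈ Icc a.2 b.2, u t (P (a.1, r)) (i + 1) ≤ 0)
    (hvb1 : ∀ r ∈ Icc a.2 b.2, 0 ≤ u t (P (b.1, r)) (i + 1))
    (hva2 : ∀ s ∈ Icc a.1 b.1, u t (P (s, a.2)) (i + 2) ≤ 0)
    (hvb2 : ∀ s ∈ Icc a.1 b.1, 0 ≤ u t (P (s, b.2)) (i + 2)) :
    ∃ D : ℝ, HasDerivWithinAt (fun s => ∫ q in Icc a b, curl (u s) (P q) i) D S t ∧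
      D ≤ ν * (∫ q in Icc a b, ∑ j, pderiv j (pderiv j fun y => curl (u t) y i) (P q)) +
        ∫ q in Icc a b, curl (f t) (P q) i := by
  refine ⟨_, hasDerivWithinAt_setIntegral_curl_plane_of_noCrossing h hSc hconv hS hcl ht i hP hab
    hua1 hub1 hua2 hub2, ?_⟩
  have hrim := rim_advection_nonneg_of_outflow i (v := u t) (w := curl (u t)) (P := P) hab
    hwa1 hwb1 hwa2 hwb2 hva1 hvb1 hva2 hvb2
  linarith

end Rate

end Summit.NavierStokesRegularity.FluidComputer.PlaneVorticityFluxLaw
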